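import Summits.ResolutionOfSingularities.ResolutionOfSingularities.Theorems.FrobeniusLadderFInjectiveMacaulayficationDesingularizationOffClosedPointsGen
import Summits.ResolutionOfSingularities.ResolutionOfSingularities.Theorems.FrobeniusLadderFInjectiveMacaulayficationLocalBlowupDesingularizationDimThree
import Summits.ResolutionOfSingularities.ResolutionOfSingularities.Theorems.FrobeniusLadderFInjectiveMacaulayficationTerminationModClosedPoints
import HarnessLib

/-!
# (LR) `LocalResolutionNonClosedGe4` — the d-uniform LOCAL RESOLUTION stub of the «LD» door at NON-CLOSED points of local dimension ≥ 4 — and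
# REGULAR OFF FINITELY MANY CLOSED POINTS in EVERY dimension modulo (LR) + the threefold package (crux `FInjectiveMacaulayfication`
# stmt-ResolutionOfSingularities-15315, chain w45a; res-L1-w45a-plan-1 RULING R17.4 «LD» (E2); seat res-L1-w45a-stub-3 g7)

[OURS · L1 W4.5a] Support file (`--supports stmt-ResolutionOfSingularities-15315 --as helper`); replaces the role of NO printed item; NOT a statement of
any manuscript; ONE definition (`@[conjecture] def`, an OURS candidate statement consumed only as a hypothesis; no instance, no notation, no named fact)
and its consumers, which are moreover CONDITIONAL on {CP 2019 Thm. 1.1 (i)(ii) `CossartPiltant2019General`, Raynaud–Gruson 5.2.2 `Stacks081R`, CP 2019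
Prop. 4.4 `CossartPiltant2019Principalization`} BY NAME. AI-written (AI review is weaker than expert review).

* `LocalResolutionNonClosedGe4` — (LR): for every integral separated finite-type `X/k` (`char k = p`) and every NON-CLOSED point `x` with
  `dim 𝒪_{X,x} ≥ 4`, every blowing up `S′` of `Spec 𝒪_{X,x}` admits a desingularization (Temkin Def. 2.2.6, `Scheme.AdmitsDesingularization`: a blowing
  up of `S′` along a centre inside `Sing S′` with regular source). ≤ S_loc(dim 𝒪_x): a desingularization of the finite-type blow-up model base-changed along
  the flat `Spec 𝒪_{X,x} → X`. VACUOUS on fourfolds (a non-closed point of a fourfold has local dimension ≤ 3). [candidate statement, OURS; open in dim ≥ 5]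
* `hloc_of_cp_of_LR` — the hypothesis of `DesingularizationOffClosedPointsGen.desingularization_offClosedPoints_of_local_gen` from CP + (LR): a non-closed
  `c` with `dim 𝒪_c ≤ 3` specialises to a point of local dimension EXACTLY `3` (`RegularOffCodimFourResidue.exists_specializes_ringKrullDim_stalk_eq`,
  dimension formula; needs `dim X ≥ 3`) where Cossart–Piltant desingularises every local blow-up (res-L1-w45a-stub-1's
  `LocalBlowupDesingularizationDimThree.localBlowups_hloc`); a non-closed `c` with `dim 𝒪_c ≥ 4` is served by (LR) itself.
* **`regularOffFinite_of_LR (hG h081R hP) (hLR) … (h3 : 3 ≤ topologicalKrullDim X)`** — every integral separated finite-type `X/k` of dimension ≥ 3 has a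
  blowing up centred in `Sing X` that is REGULAR off the preimage of FINITELY MANY CLOSED POINTS, modulo (LR) and the threefold package (on fourfolds (LR)
  is idle and this is THEOREM A(4)).
[cite: Temkin2008, Prop. 2.3.4; Def. 2.2.6] [cite: CossartPiltant2019, Thm. 1.1 (i)(ii); Prop. 4.4] [cite: GortzWedhorn2020, Thm. 5.22]
-/

-- single-problem summit: the doubled namespace component is forced
set_option linter.dupNamespace false

noncomputable section

namespace Summit.ResolutionOfSingularities.ResolutionOfSingularities.Theorems.FInjectiveMacaulayfication.RegularOffFiniteOfLR

open CategoryTheory CategoryTheory.Limits AlgebraicGeometry TopologicalSpace IsLocalRing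
open Literature.AlgebraicGeometry.Resolution
open Summit.ResolutionOfSingularities.ResolutionOfSingularities.Theorems.FInjectiveMacaulayfication

/-! ## §1 The candidate (LR) -/

/-- [OURS · candidate statement, the «LD» door's LOCAL RESOLUTION stub] **(LR) `LocalResolutionNonClosedGe4`**: for every prime `p`, field `k` of
characteristic `p`, INTEGRAL separated finite-type `k`-scheme `X` and NON-CLOSED point `x ∈ X` with `4 ≤ dim 𝒪_{X,x}`, every blowing up
`g : S′ → Spec 𝒪_{X,x}` along an ideal sheaf `I` admits a desingularization (`Scheme.AdmitsDesingularization S′`, Temkin 2008 Def. 2.2.6). Vacuous when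
`dim X ≤ 4`; it is the d ≥ 5 part of resolution that the F-ladder does NOT spare (plan-1 R17.4: below the top dimension genuine resolution is needed to
keep «regular off the fibre»). [candidate statement, OURS; open] [cite: Temkin2008, Def. 2.2.6] -/
@[conjecture] def LocalResolutionNonClosedGe4 : Prop :=
  ∀ (p : ℕ), p.Prime → ∀ (k : Type) [Field k] [CharP k p]
    (X : Scheme.{0}) (f : X ⟶ Spec (.of k)),
      IsSeparated f → LocallyOfFiniteType f → QuasiCompact f → IsIntegral X →
      ∀ x : X, ¬ IsClosed ({x} : Set X) → (4 : WithBot ℕ∞) ≤ ringKrullDim (X.presheaf.stalk x) →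
      ∀ (S' : Scheme.{0}) (g : S' ⟶ Spec (X.presheaf.stalk x)) (I : (Spec (X.presheaf.stalk x)).IdealSheafData),
        IsBlowup g I → Scheme.AdmitsDesingularization S'

/-! ## §2 The hypothesis of THEOREM A-gen from CP + (LR) -/

/-- **(hloc) of `desingularization_offClosedPoints_of_local_gen` from Cossart–Piltant below local dimension 4 and (LR) at local dimension ≥ 4** (`X`
integral of finite type over `k`, `dim X ≥ 3`). [OURS · conditional-result] [cite: CossartPiltant2019, Thm. 1.1 (i)(ii); Prop. 4.4]
[cite: GortzWedhorn2020, Thm. 5.22] -/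
theorem hloc_of_cp_of_LR
    (hG : CossartPiltant2019General.{0}) (h081R : Stacks081R.{0}) (hP : CossartPiltant2019Principalization.{0})
    (hLR : LocalResolutionNonClosedGe4)
    (p : ℕ) (hp : p.Prime) (k : Type) [Field k] [CharP k p] (X : Scheme.{0}) (f₀ : X ⟶ Spec (.of k))
    [IsSeparated f₀] [LocallyOfFiniteType f₀] [QuasiCompact f₀] [IsIntegral X] (h3 : (3 : WithBot ℕ∞) ≤ topologicalKrullDim X) :
    ∀ c : X, ¬ IsClosed ({c} : Set X) → ∃ x : X, c ⤳ x ∧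
      ∀ (S' : Scheme.{0}) (g : S' ⟶ Spec (X.presheaf.stalk x)) (I : (Spec (X.presheaf.stalk x)).IdealSheafData),
        IsBlowup g I → Scheme.AdmitsDesingularization S' := by
  intro c hc
  haveI : IsLocallyNoetherian X := LocallyOfFiniteType.isLocallyNoetherian f₀
  haveI : CompactSpace X := QuasiCompact.compactSpace_of_compactSpace f₀
  -- `dim X = d ≥ 3` and `dim 𝒪_c = n`, natural numbers
  obtain ⟨d₀, hd₀⟩ := exists_topologicalKrullDim_le_of_locallyOfFiniteType f₀
  obtain ⟨d, hd⟩ := exists_topologicalKrullDim_eq_nat hd₀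
  have h3d : 3 ≤ d := by
    rw [hd] at h3
    exact_mod_cast h3
  obtain ⟨n, hn⟩ := exists_nat_cast_eq_ringKrullDim (R := X.presheaf.stalk c)
  by_cases hn3 : n ≤ 3
  · -- specialise `c` to a point `x` of local dimension exactly `3`, where Cossart–Piltant desingularises every local blow-up
    obtain ⟨x, hcx, hx3⟩ := RegularOffCodimFourResidue.exists_specializes_ringKrullDim_stalk_eq f₀ hd c (n := 3)
      (by rw [hn]; exact_mod_cast hn3) h3d
    exact ⟨x, hcx, LocalBlowupDesingularizationDimThree.localBlowups_hloc hG h081R hP f₀ x hx3⟩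
  · -- `dim 𝒪_c ≥ 4`: (LR) at `c` itself
    refine ⟨c, specializes_rfl, hLR p hp k X f₀ inferInstance inferInstance inferInstance inferInstance c hc ?_⟩
    rw [hn]
    exact_mod_cast (by omega : 4 ≤ n)

/-! ## §3 Regular off finitely many closed points, every dimension ≥ 3, modulo (LR) -/

/-- **REGULAR OFF FINITELY MANY CLOSED POINTS in every dimension ≥ 3, modulo (LR) and the threefold package**: for `X` integral separated of finite
type over `k` with `dim X ≥ 3` there are a blowing up `f : X′ → X` along `J` with `Supp J ⊆ (Reg X)ᶜ` and a closed FINITE set `F` of CLOSED points with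
`X′` regular at every point not over `F` (= the ∃-shape of `DesingularizationOffClosedPoints.desingularization_offFinite_of_local`; on fourfolds (LR) is
idle and this is THEOREM A(4)). [OURS · conditional-result] [cite: Temkin2008, Prop. 2.3.4] [cite: CossartPiltant2019, Thm. 1.1 (i)(ii); Prop. 4.4] -/
theorem regularOffFinite_of_LR
    (hG : CossartPiltant2019General.{0}) (h081R : Stacks081R.{0}) (hP : CossartPiltant2019Principalization.{0})
    (hLR : LocalResolutionNonClosedGe4)
    (p : ℕ) (hp : p.Prime) (k : Type) [Field k] [CharP k p] (X : Scheme.{0}) (f₀ : X ⟶ Spec (.of k))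
    [IsSeparated f₀] [LocallyOfFiniteType f₀] [QuasiCompact f₀] [IsIntegral X] (h3 : (3 : WithBot ℕ∞) ≤ topologicalKrullDim X) :
    ∃ (X' : Scheme.{0}) (f : X' ⟶ X) (J : X.IdealSheafData) (F : Set X), IsBlowup f J ∧
      (J.support : Set X) ⊆ (Scheme.regularLocus X)ᶜ ∧ IsClosed F ∧ F.Finite ∧ (∀ b ∈ F, IsClosed ({b} : Set X)) ∧
      ∀ x' : X', f x' ∉ F → x' ∈ Scheme.regularLocus X' := by
  have hk : Scheme.IsQuasiExcellent (Spec (.of k)) :=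
    Scheme.isQuasiExcellent_of_locallyOfFiniteType Stacks07QW_field_holds (𝟙 (Spec (.of k)))
  haveI : IsNoetherianRing (CommRingCat.of k) := inferInstanceAs (IsNoetherianRing k)
  exact DesingularizationOffClosedPointsGen.desingularization_offFinite_of_local_gen hk f₀ (hloc_of_cp_of_LR hG h081R hP hLR p hp k X f₀ h3)

/-- The same with `J ≠ ⊥` recorded (the generic point is regular, hence off `Supp J`). [OURS · conditional-result] [cite: Temkin2008, Prop. 2.3.4] -/
theorem regularOffFinite_of_LR'
    (hG : CossartPiltant2019General.{0}) (h081R : Stacks081R.{0}) (hP : CossartPiltant2019Principalization.{0})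
    (hLR : LocalResolutionNonClosedGe4)
    (p : ℕ) (hp : p.Prime) (k : Type) [Field k] [CharP k p] (X : Scheme.{0}) (f₀ : X ⟶ Spec (.of k))
    [IsSeparated f₀] [LocallyOfFiniteType f₀] [QuasiCompact f₀] [IsIntegral X] (h3 : (3 : WithBot ℕ∞) ≤ topologicalKrullDim X) :
    ∃ (X' : Scheme.{0}) (f : X' ⟶ X) (J : X.IdealSheafData) (F : Set X), IsBlowup f J ∧ J ≠ ⊥ ∧
      (J.support : Set X) ⊆ (Scheme.regularLocus X)ᶜ ∧ IsClosed F ∧ F.Finite ∧ (∀ b ∈ F, IsClosed ({b} : Set X)) ∧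
      ∀ x' : X', f x' ∉ F → x' ∈ Scheme.regularLocus X' := by
  obtain ⟨X', f, J, F, hf, hJ, hFc, hF, hFcl, hreg⟩ := regularOffFinite_of_LR hG h081R hP hLR p hp k X f₀ h3
  refine ⟨X', f, J, F, hf, fun h0 => ?_, hJ, hFc, hF, hFcl, hreg⟩
  have hgen : genericPoint X ∈ (J.support : Set X) := by rw [h0, Scheme.IdealSheafData.support_bot]; trivial
  have := hJ hgen
  rw [Set.mem_compl_iff, Scheme.mem_regularLocus] at this
  exact this (inferInstanceAs (IsRegularLocalRing X.functionField))

end Summit.ResolutionOfSingularities.ResolutionOfSingularities.Theorems.FInjectiveMacaulayfication.RegularOffFiniteOfLR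

end
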